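import Mathlib.NumberTheory.LegendreSymbol.JacobiSymbol
import Literature.NumberTheory.EllipticCurves.IsogenyDegreeQuadraticFormProofs
import Literature.NumberTheory.EllipticCurves.IsogenyDegreeProofs
import Literature.NumberTheory.EllipticCurves.IsogenyGeomEndRingProofs
import Literature.NumberTheory.EllipticCurves.TateModuleDeterminantProofs
import Literature.NumberTheory.EllipticCurves.WeilPairingProofs
import Literature.NumberTheory.EllipticCurves.GaloisActionProofs
import HarnessLib

/-!
# No elliptic curve over `ℚ` has `ℚ`-rational complex multiplication: proof of `not_hasRationalCM`

Sibling *proofs* file of `Literature.NumberTheory.EllipticCurves.Isogeny` (D-0014 append protocol: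
nothing is defined, every declaration is a theorem). It discharges the named fact

* `WeierstrassCurve.not_hasRationalCM : ∀ (W : WeierstrassCurve ℚ) [W.IsElliptic], ¬ W.HasRationalCM`
  — `End_ℚ(E) = ℤ` for every elliptic curve `E / ℚ` (Silverman, *Advanced Topics in the
  Arithmetic of Elliptic Curves*, Thm. II.2.2(a) with Remark II.2.2.2, PDF pp. 110–112: for
  `σ ∈ Aut(ℂ)` one has `[α]_E^σ = [α^σ]_{E^σ}`; for `E` defined over `ℚ` and `σ` complex
  conjugation an endomorphism `[α]` defined over `ℚ` therefore has `α = ᾱ`, i.e. `α ∈ R ∩ ℝ = ℤ`),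

as `WeierstrassCurve.not_hasRationalCM_holds`.

## The proof

The printed argument normalises `[·] : R ≅ End(E)` through the invariant differential
(`[α]^* ω = α ω`, *Advanced Topics* Prop. II.1.1, *AEC* III.5) and reads the action of complex
conjugation on `α ∈ ℂ`. The tree has neither invariant differentials nor the analytic
parametrisation, but it has the `ℓ`-adic representation with everything needed, all *proved*:
`T_ℓ E ≅ ℤ_ℓ²` (`module_free_tateModule_holds`, `finrank_tateModule_eq_two_holds`),
`det(φ_ℓ) = deg φ` (*AEC* Prop. III.8.6, `Isogeny.det_tateModule_map_eq_deg_holds`),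
`det ρ_ℓ(σ) ≡ c (mod ℓⁿ⁺¹)` when `σ` acts on `μ_{ℓⁿ⁺¹}` by `t ↦ t^c` (*AEC* Prop. III.8.1 and the
proof of III.8.6, `toZModPow_det_galoisRepTate_eq` with `exists_weilPairing_holds`),
`End_{K̄}(E) = {0} ∪ {algebraic maps}` (`mem_geomEndRing_iff_holds`), `deg ≥ 1`
(`Isogeny.deg_pos_holds`), `#E[2] = 4` (`card_torsionPoints_eq_sq_holds`) and complex conjugations
in `Γ_ℚ` (`Literature.NumberTheory.GaloisRepresentations.exists_isComplexConjugation`). So we run the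
same idea — *an endomorphism defined over `ℚ` commutes with complex conjugation, which forces its
eigenvalue to be "real", hence rational* — `ℓ`-adically:

1. Let `φ ∈ End_ℚ(E)` with `φ ≠ [n]` for all `n ∈ ℤ`. Then `φ, 1 - φ ≠ 0` are isogenies over `ℚ`;
   put `d = deg φ`, `t = 1 + deg φ - deg(1 - φ) ∈ ℤ`. For every prime `ℓ`, in a `ℤ_ℓ`-basis of
   `T_ℓ E`, `End_ℚ(E) → M₂(ℤ_ℓ)` is a ring map with `det = deg` on isogenies
   (`exists_tateMatrixRep`), so `det φ_ℓ = d` and `tr φ_ℓ = 1 + det φ_ℓ - det(1 - φ_ℓ) = t`.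
2. `ψ = 2φ - t ≠ 0` (a point of order `2` shows `t` is even if `2φ = t`, and `End_ℚ(E)` is
   torsion-free since a non-zero endomorphism has finite kernel), so
   `0 < deg ψ = det(2φ_ℓ - t) = 4d - t²`: the discriminant `D = t² - 4d` is negative.
3. `J(D | 4|D| - 1) = χ₄(4|D| - 1) · J(|D| | 4|D| - 1) = -1` (as `4|D| ≡ 1` and `J(4 | ·) = 1`), so some
   odd prime `ℓ ∣ 4|D| - 1` has `(D/ℓ) = -1` (Mathlib `jacobiSym.eq_neg_one_at_prime_divisor_of_eq_neg_one`).
4. A complex conjugation `c ∈ Γ_ℚ` inverts all roots of unity, hence `det ρ_ℓ(c) = -1`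
   (`det_galoisRepTate_eq_neg_one_of_smul_eq_inv`), `ρ_ℓ(c)² = 1`, and `φ_ℓ` commutes with `ρ_ℓ(c)`
   because `φ` is defined over `ℚ`.
5. Over the field `𝔽_ℓ` (`ℓ` odd): if `A` commutes with `C`, `C² = 1`, `det C = -1`, then
   `tr(A)² - 4 det(A)` is a square (`isSquare_trace_sq_sub_four_mul_det`: `A` preserves the two
   eigenlines of the reflection `C`). Reducing `φ_ℓ, ρ_ℓ(c)` modulo `ℓ` makes `D` a square mod `ℓ`,
   contradicting step 3.

## References

* [SilvermanAdvancedTopics1994] J. H. Silverman, *Advanced Topics in the Arithmetic of Elliptic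
  Curves*, GTM 151, Springer 1994: Thm. II.2.2(a) and its proof, Remark II.2.2.2 (PDF pp. 110–112;
  read: `lit read book:silverman1994-advanced-topics-arithmetic-elliptic-curves`, pp. 110–112).
* [SilvermanAEC2009] J. H. Silverman, *The Arithmetic of Elliptic Curves*, 2nd ed., GTM 106,
  Springer 2009: III.§4 (`End(E)`, Example III.4.4: "`[i]` is defined over `K` iff `i ∈ K`"),
  Cor. III.6.3, III.§7, Prop. III.8.1, Prop. III.8.6 (all consumed through the tree's proved theorems).

## Design

`noncomputable section`, `open scoped Classical`, one universe `u`; curve-specific theorems are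
deliberate dot-notation extensions in `namespace WeierstrassCurve` (as the prelude `Isogeny` and its
other proofs files), the generic lemmas (Jacobi symbols, `2 × 2` matrices, complex conjugation in
`Γ_ℚ`) live in `namespace Literature.NumberTheory.EllipticCurves`. No definitions: the ring map
`End_K(E) → M₂(ℤ_ℓ)` and the complex conjugation are produced existentially.
-/

noncomputable section

open scoped Classical

universe u

namespace Literature.NumberTheory.EllipticCurves

/-! ## Arithmetic input: a negative integer is a non-residue at some odd prime -/

/-- For `m ≥ 1`, the Jacobi symbol `J(-m | 4m - 1)` equals `-1`: `J(-m | N) = χ₄(N) J(m | N)` with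
`N = 4m - 1 ≡ 3 (mod 4)`, and `J(m | N) = J(4 | N) J(m | N) = J(4m | N) = J(1 | N) = 1`. [folklore] -/
theorem jacobiSym_neg_natCast_four_mul_sub_one {m : ℕ} (hm : 0 < m) :
    jacobiSym (-(m : ℤ)) (4 * m - 1) = -1 := by
  have hN3 : (4 * m - 1) % 4 = 3 := by omega
  have hodd : Odd (4 * m - 1) := Nat.odd_iff.mpr (by omega)
  have hmod : (4 * (m : ℤ)) % ((4 * m - 1 : ℕ) : ℤ) = 1 := by
    have hcast : ((4 * m - 1 : ℕ) : ℤ) = 4 * (m : ℤ) - 1 := by omega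
    rw [hcast]
    calc (4 * (m : ℤ)) % (4 * (m : ℤ) - 1)
        = (1 + (4 * (m : ℤ) - 1) * 1) % (4 * (m : ℤ) - 1) := by congr 1; ring
      _ = 1 := by
        rw [Int.add_mul_emod_self_left]
        exact Int.emod_eq_of_lt (by norm_num) (by omega)
  have h4m : jacobiSym (4 * (m : ℤ)) (4 * m - 1) = 1 := by
    rw [jacobiSym.mod_left, hmod]
    exact jacobiSym.one_left _
  have hm1 : jacobiSym (m : ℤ) (4 * m - 1) = 1 := by
    rwa [jacobiSym.mul_left, jacobiSym.at_four hodd, one_mul] at h4m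
  rw [jacobiSym.neg _ hodd, ZMod.χ₄_nat_three_mod_four hN3, hm1]
  norm_num

/-- A negative integer `D` is a quadratic non-residue modulo some odd prime: some prime divisor
`ℓ` of `4|D| - 1` has `J(D | ℓ) = -1` (from `jacobiSym_neg_natCast_four_mul_sub_one` and Mathlib's
`jacobiSym.eq_neg_one_at_prime_divisor_of_eq_neg_one`; no Dirichlet theorem is needed). [folklore] -/
theorem exists_prime_jacobiSym_eq_neg_one {D : ℤ} (hD : D < 0) :
    ∃ p : ℕ, p.Prime ∧ p ≠ 2 ∧ jacobiSym D p = -1 := by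
  obtain ⟨m, hm0, rfl⟩ : ∃ m : ℕ, 0 < m ∧ D = -(m : ℤ) := ⟨D.natAbs, by omega, by omega⟩
  have hodd : Odd (4 * m - 1) := Nat.odd_iff.mpr (by omega)
  obtain ⟨p, hp, hpd, hJ⟩ := jacobiSym.eq_neg_one_at_prime_divisor_of_eq_neg_one
    (jacobiSym_neg_natCast_four_mul_sub_one hm0)
  refine ⟨p, hp, ?_, hJ⟩
  rintro rfl
  exact (Nat.not_even_iff_odd.mpr hodd) (even_iff_two_dvd.mpr hpd)

/-! ## Linear algebra input: an endomorphism commuting with a reflection of the plane -/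

/-- Over a field of characteristic `≠ 2`: if a `2 × 2` matrix `A` commutes with a matrix `C` with
`C² = 1` and `det C = -1` (a reflection: eigenvalues `1` and `-1`, each on a line), then the
discriminant `tr(A)² - 4 det(A)` of the characteristic polynomial of `A` is a square (`A` preserves
the two eigenlines, so its characteristic polynomial splits). Proved by a direct computation with
the entries. [folklore] -/
theorem isSquare_trace_sq_sub_four_mul_det {F : Type*} [Field F] (h2 : (2 : F) ≠ 0)
    {A C : Matrix (Fin 2) (Fin 2) F} (hC : C * C = 1) (hdet : C.det = -1) (hAC : A * C = C * A) :
    IsSquare (A.trace ^ 2 - 4 * A.det) := by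
  obtain ⟨p, q, r, s, rfl⟩ : ∃ p q r s : F, C = !![p, q; r, s] :=
    ⟨C 0 0, C 0 1, C 1 0, C 1 1, Matrix.eta_fin_two C⟩
  obtain ⟨e, f, g, h, rfl⟩ : ∃ e f g h : F, A = !![e, f; g, h] :=
    ⟨A 0 0, A 0 1, A 1 0, A 1 1, Matrix.eta_fin_two A⟩
  rw [Matrix.det_fin_two_of] at hdet
  rw [Matrix.trace_fin_two_of, Matrix.det_fin_two_of]
  rw [Matrix.mul_fin_two, Matrix.one_fin_two] at hC
  rw [Matrix.mul_fin_two, Matrix.mul_fin_two] at hAC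
  have c11 := congrFun (congrFun hC 0) 0
  have c12 := congrFun (congrFun hC 0) 1
  have c21 := congrFun (congrFun hC 1) 0
  have a11 := congrFun (congrFun hAC 0) 0
  have a12 := congrFun (congrFun hAC 0) 1
  simp only [Matrix.of_apply, Matrix.cons_val', Matrix.cons_val_zero, Matrix.cons_val_one,
    Matrix.cons_val_fin_one, Matrix.empty_val'] at c11 c12 c21 a11 a12
  -- `C` is a reflection: `s = -p`
  have hs : s = -p := by
    by_contra hs
    have hps : p + s ≠ 0 := fun h0 ↦ hs (by linear_combination h0)
    have hq : q = 0 := by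
      have : q * (p + s) = 0 := by linear_combination c12
      exact (mul_eq_zero.mp this).resolve_right hps
    have hr : r = 0 := by
      have : r * (p + s) = 0 := by linear_combination c21
      exact (mul_eq_zero.mp this).resolve_right hps
    subst hq hr
    have hp0 : p ≠ 0 := by
      rintro rfl
      norm_num at c11
    have : p * (p + s) = 0 := by linear_combination c11 + hdet
    exact hps ((mul_eq_zero.mp this).resolve_left hp0)
  subst hs
  -- the commutation relations
  have E1 : q * (e - h) = 2 * p * f := by linear_combination a12
  have E2 : f * r = q * g := by linear_combination a11
  by_cases hq : q = 0
  · subst hq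
    have hp0 : p ≠ 0 := by
      rintro rfl
      norm_num at c11
    have hf : f = 0 := by
      have : 2 * p * f = 0 := by linear_combination -E1
      rcases mul_eq_zero.mp this with h | h
      · exact absurd h (mul_ne_zero h2 hp0)
      · exact h
    subst hf
    exact ⟨e - h, by ring⟩
  · have key : q ^ 2 * ((e + h) ^ 2 - 4 * (e * h - f * g)) = (2 * f) ^ 2 := by
      linear_combination (q * (e - h) + 2 * p * f) * E1 - 4 * q * f * E2 + 4 * f ^ 2 * c11
    refine ⟨2 * f / q, ?_⟩
    field_simp
    linear_combination key

/-- `tr(A) = 1 + det(A) - det(1 - A)` for a `2 × 2` matrix (Silverman, *AEC*, end of the proof of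
Prop. III.8.6: "a trivial calculation"). [folklore] -/
theorem Matrix.trace_fin_two_eq_one_add_det_sub_det {R : Type*} [CommRing R]
    (A : Matrix (Fin 2) (Fin 2) R) : A.trace = 1 + A.det - (1 - A).det := by
  rw [Matrix.trace_fin_two, Matrix.det_fin_two, Matrix.det_fin_two]
  simp only [Matrix.sub_apply, Matrix.one_apply_eq, Matrix.one_apply_ne (by decide : (0 : Fin 2) ≠ 1),
    Matrix.one_apply_ne (by decide : (1 : Fin 2) ≠ 0)]
  ring

/-- `det(2A - t) = 4 det(A) - 2t tr(A) + t²` for a `2 × 2` matrix `A` and an integer `t` (the value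
of the binary quadratic form `det(m + nA) = m² + tr(A) mn + det(A) n²` at `(m, n) = (-t, 2)`). [folklore] -/
theorem Matrix.det_add_self_sub_intCast_fin_two {R : Type*} [CommRing R]
    (A : Matrix (Fin 2) (Fin 2) R) (t : ℤ) :
    (A + A - (t : Matrix (Fin 2) (Fin 2) R)).det = 4 * A.det - 2 * t * A.trace + (t : R) ^ 2 := by
  rw [Matrix.det_fin_two, Matrix.det_fin_two, Matrix.trace_fin_two]
  simp only [Matrix.sub_apply, Matrix.add_apply, Matrix.intCast_apply]
  simp only [if_true, if_neg (by decide : (0 : Fin 2) ≠ 1), if_neg (by decide : (1 : Fin 2) ≠ 0)]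
  ring

/-! ## Complex conjugation in `Γ_ℚ` inverts the roots of unity -/

/-- There is a complex conjugation `c ∈ Γ_ℚ = Gal(ℚ̄/ℚ)`: an involution acting on every root of
unity `ζ ∈ ℚ̄` by `ζ ↦ ζ⁻¹` (under an embedding `ι : ℚ̄ → ℂ` with `ι ∘ c = conj ∘ ι`, the tree's
`Literature.NumberTheory.GaloisRepresentations.exists_isComplexConjugation`, one has
`ι(c ζ) = conj(ι ζ) = (ι ζ)⁻¹` since `|ι ζ| = 1`). Silverman, *Advanced Topics*, Remark II.2.2.2
(`i^σ = -i` for `σ` complex conjugation). [folklore] -/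
theorem exists_absoluteGaloisGroup_rat_smul_eq_inv :
    ∃ c : Field.absoluteGaloisGroup ℚ, c * c = 1 ∧
      ∀ (t : AlgebraicClosure ℚ) (N : ℕ), N ≠ 0 → t ^ N = 1 → c • t = t⁻¹ := by
  obtain ⟨c, hc⟩ :=
    Literature.NumberTheory.GaloisRepresentations.exists_isComplexConjugation (Rat.castHom ℝ)
  refine ⟨c, by rw [← pow_two]; exact hc.sq_eq_one, fun t N hN ht ↦ ?_⟩
  obtain ⟨ι, -, hι⟩ :=
    Literature.NumberTheory.GaloisRepresentations.isComplexConjugation_iff.mp hc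
  apply ι.injective
  rw [hι, map_inv₀]
  have hz : (ι t) ^ N = 1 := by rw [← map_pow, ht, map_one]
  have hnorm : ‖ι t‖ = 1 := by
    have h := congrArg norm hz
    rw [norm_pow, norm_one] at h
    exact (pow_eq_one_iff_of_nonneg (norm_nonneg _) hN).mp h
  rw [Complex.inv_def, Complex.normSq_eq_norm_sq, hnorm]
  simp

end Literature.NumberTheory.EllipticCurves

namespace WeierstrassCurve

open Literature.NumberTheory.EllipticCurves

variable {K : Type u} [Field K] (W : WeierstrassCurve K)

/-! ## `End_K(E)`: non-zero elements are isogenies; torsion-freeness; a point of order `2` -/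

/-- A non-zero element of `End_K(E) = W.endRing` is (the map on points of) an isogeny `E → E`
defined over `K`: it is algebraic by `End_{K̄}(E) = {0} ∪ {algebraic}` (the tree's
`mem_geomEndRing_iff_holds`, Silverman, *AEC*, III.§4), `Γ_K`-equivariant by definition of
`endRing`, and has finite kernel (`IsAlgebraicOn.finite_ker`). [folklore] -/
theorem exists_isogeny_of_mem_endRing [W.IsElliptic] {φ : AddMonoid.End W.geomPoints}
    (hφ : φ ∈ W.endRing) (h0 : φ ≠ 0) : ∃ ψ : Isogeny W W, ψ.toAddMonoidHom = φ := by
  have halg : IsAlgebraicOn W W φ := ((mem_geomEndRing_iff_holds W φ).mp hφ.1).resolve_left h0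
  exact ⟨⟨φ, halg, hφ.2, IsAlgebraicOn.finite_ker halg⟩, rfl⟩

/-- `End_K(E)` is torsion-free: if `φ ∈ End_K(E)` and `m • φ = 0` for an integer `m ≠ 0`, then
`φ = 0` — otherwise `φ` is an isogeny, so has finite kernel and finite fibres, while `φ` maps the
infinite group `E(K̄)` into the finite group `E[m]`. Silverman, *AEC*, Prop. III.4.2(b).
[cite: SilvermanAEC2009, Prop. III.4.2(b)] -/
theorem eq_zero_of_mem_endRing_of_zsmul_apply_eq_zero [W.IsElliptic]
    {φ : AddMonoid.End W.geomPoints} (hφ : φ ∈ W.endRing) {m : ℤ} (hm : m ≠ 0)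
    (h : ∀ P : W.geomPoints, m • φ P = 0) : φ = 0 := by
  by_contra h0
  obtain ⟨ψ, hψ⟩ := W.exists_isogeny_of_mem_endRing hφ h0
  haveI : Finite (geomTorsion W m) := finite_torsionPoints_holds W (AlgebraicClosure K) hm
  have hker : ((φ : W.geomPoints →+ W.geomPoints).ker : Set W.geomPoints).Finite := by
    rw [← hψ]
    exact ψ.finite_ker
  have hfin : ((φ : W.geomPoints →+ W.geomPoints) ⁻¹'
      (geomTorsion W m : Set W.geomPoints)).Finite :=
    AddMonoidHom.finite_preimage_of_finite_ker _ hker (Set.toFinite _)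
  have huniv : ((φ : W.geomPoints →+ W.geomPoints) ⁻¹'
      (geomTorsion W m : Set W.geomPoints)) = Set.univ :=
    Set.eq_univ_of_forall fun P ↦ (mem_torsionPoints_iff W (AlgebraicClosure K) (φ P)).mpr (h P)
  rw [huniv] at hfin
  exact Set.infinite_univ hfin

/-- An elliptic curve over a field with `2 ≠ 0` has a geometric point of exact order `2`
(`#E[2] = 4`, Silverman, *AEC*, Cor. III.6.4(b); the tree's `card_torsionPoints_eq_sq_holds`).
[cite: SilvermanAEC2009, Cor. III.6.4(b)] -/
theorem exists_two_torsion_ne_zero [W.IsElliptic] (h2 : ((2 : ℕ) : AlgebraicClosure K) ≠ 0) :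
    ∃ P : W.geomPoints, (2 : ℤ) • P = 0 ∧ P ≠ 0 := by
  have hcard : Nat.card (geomTorsion W ((2 : ℕ) : ℤ)) = 2 ^ 2 :=
    card_torsionPoints_eq_sq_holds W (AlgebraicClosure K) h2
  haveI : Finite (geomTorsion W ((2 : ℕ) : ℤ)) :=
    Nat.finite_of_card_ne_zero (by rw [hcard]; norm_num)
  haveI : Nontrivial (geomTorsion W ((2 : ℕ) : ℤ)) :=
    Finite.one_lt_card_iff_nontrivial.mp (by rw [hcard]; norm_num)
  obtain ⟨⟨P, hP⟩, hP0⟩ := exists_ne (0 : geomTorsion W ((2 : ℕ) : ℤ))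
  refine ⟨P, ?_, fun h ↦ hP0 (Subtype.ext h)⟩
  have hP' : ((2 : ℕ) : ℤ) • P = 0 := (Submodule.mem_torsionBy_iff _ P).mp hP
  exact_mod_cast hP'

/-! ## The `ℓ`-adic representation of `End_K(E)` and `Γ_K` by `2 × 2` matrices -/

/-- **`End_K(E) → M₂(ℤ_ℓ)` and `Γ_K → M₂(ℤ_ℓ)`.** For an elliptic curve `E / K` and a prime
`ℓ ≠ char K`, a `ℤ_ℓ`-basis of `T_ℓ E ≅ ℤ_ℓ²` (Silverman, *AEC*, Prop. III.7.1; the tree's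
`module_free_tateModule_holds`, `finrank_tateModule_eq_two_holds`) turns `f ↦ T_ℓ f` into a ring
map `R` on the additive endomorphisms of `E(K̄)` and `σ ↦ ρ_ℓ(σ)` into a monoid map `S` on `Γ_K`
with: `det R(φ) = deg φ` for isogenies `φ` over `K` (Prop. III.8.6, the tree's
`Isogeny.det_tateModule_map_eq_deg_holds`), `det S(σ) = det ρ_ℓ(σ)`, and `R(f) S(σ) = S(σ) R(f)`
for `Γ_K`-equivariant `f` (*AEC* III.§7, Thm. III.7.4: `T_ℓ φ` is a `Γ_K`-module map).
[cite: SilvermanAEC2009, Prop. III.8.6 and III.§7] -/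
theorem exists_tateMatrixRep [W.IsElliptic] (ℓ : ℕ) [Fact ℓ.Prime] (hℓ : (ℓ : K) ≠ 0) :
    ∃ (R : AddMonoid.End W.geomPoints →+* Matrix (Fin 2) (Fin 2) ℤ_[ℓ])
      (S : Field.absoluteGaloisGroup K →* Matrix (Fin 2) (Fin 2) ℤ_[ℓ]),
      (∀ ψ : Isogeny W W, (R ψ.toAddMonoidHom).det = ψ.deg) ∧
      (∀ σ, (S σ).det =
        LinearMap.det (W.galoisRepTate ℓ σ : W.tateModule ℓ →ₗ[ℤ_[ℓ]] W.tateModule ℓ)) ∧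
      ∀ f ∈ W.equivariantSubring, ∀ σ, R f * S σ = S σ * R f := by
  haveI := module_free_tateModule_holds W ℓ
  haveI := module_finite_tateModule_holds W ℓ
  let b := Module.finBasisOfFinrankEq ℤ_[ℓ] (W.tateModule ℓ) (finrank_tateModule_eq_two_holds W ℓ hℓ)
  let e : Module.End ℤ_[ℓ] (W.tateModule ℓ) ≃ₐ[ℤ_[ℓ]] Matrix (Fin 2) (Fin 2) ℤ_[ℓ] :=
    LinearMap.toMatrixAlgEquiv b
  let ρT : AddMonoid.End W.geomPoints →+* Module.End ℤ_[ℓ] (W.tateModule ℓ) :=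
    { toFun := fun f ↦ TateModule.map ℓ f
      map_one' := TateModule.map_id
      map_mul' := fun _ _ ↦ TateModule.map_comp _ _
      map_zero' := LinearMap.ext fun _ ↦ TateModule.ext fun _ ↦ rfl
      map_add' := fun _ _ ↦ LinearMap.ext fun _ ↦ TateModule.ext fun _ ↦ rfl }
  refine ⟨e.toRingEquiv.toRingHom.comp ρT,
    e.toRingEquiv.toRingHom.toMonoidHom.comp (W.galoisRepTate ℓ), fun ψ ↦ ?_, fun σ ↦ ?_,
    fun f hf σ ↦ ?_⟩
  · change (LinearMap.toMatrix b b (TateModule.map ℓ ψ.toAddMonoidHom)).det = _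
    rw [LinearMap.det_toMatrix]
    exact Isogeny.det_tateModule_map_eq_deg_holds W ℓ hℓ ψ
  · change (LinearMap.toMatrix b b (W.galoisRepTate ℓ σ)).det = _
    rw [LinearMap.det_toMatrix]
  · change e (TateModule.map ℓ f) * e (W.galoisRepTate ℓ σ) =
      e (W.galoisRepTate ℓ σ) * e (TateModule.map ℓ f)
    rw [← map_mul, ← map_mul]
    congr 1
    exact LinearMap.ext fun x ↦ TateModule.ext fun n ↦ hf σ _

/-- **`det ρ_ℓ(c) = -1` for an automorphism inverting the roots of unity.** If `c ∈ Γ_K` acts on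
every root of unity of `K̄` by `t ↦ t⁻¹` (e.g. a complex conjugation), then `det(c | T_ℓ E) = -1`
for every prime `ℓ ≠ char K`: at each level `c` acts on `μ_{ℓⁿ⁺¹}` as `t ↦ t^{ℓⁿ⁺¹ - 1}`, so
`det ≡ ℓⁿ⁺¹ - 1 ≡ -1 (mod ℓⁿ⁺¹)` by the Weil pairing (Silverman, *AEC*, Prop. III.8.1 and the proof
of Prop. III.8.6; the tree's `toZModPow_det_galoisRepTate_eq` and `exists_weilPairing_holds`).
[cite: SilvermanAEC2009, Prop. III.8.1 and proof of Prop. III.8.6] -/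
theorem det_galoisRepTate_eq_neg_one_of_smul_eq_inv [PerfectField K] [W.IsElliptic] (ℓ : ℕ)
    [Fact ℓ.Prime] (hℓ : (ℓ : K) ≠ 0) {c : Field.absoluteGaloisGroup K}
    (hc : ∀ (t : AlgebraicClosure K) (N : ℕ), N ≠ 0 → t ^ N = 1 → c • t = t⁻¹) :
    LinearMap.det (W.galoisRepTate ℓ c : W.tateModule ℓ →ₗ[ℤ_[ℓ]] W.tateModule ℓ) = -1 := by
  have hp : ℓ.Prime := Fact.out
  have h0 : ∀ x y : ZMod (ℓ ^ 0), x = y := by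
    rw [pow_zero]
    exact fun x y ↦ Subsingleton.elim x y
  refine PadicInt.ext_of_toZModPow.mp fun n ↦ ?_
  cases n with
  | zero => exact h0 _ _
  | succ n =>
    have hN : ℓ ^ (n + 1) ≠ 0 := pow_ne_zero _ hp.ne_zero
    have h1 : 1 ≤ ℓ ^ (n + 1) := Nat.one_le_iff_ne_zero.mpr hN
    have hct : ∀ t : AlgebraicClosure K, t ^ ℓ ^ (n + 1) = 1 → c • t = t ^ (ℓ ^ (n + 1) - 1) := by
      intro t ht
      rw [hc t _ hN ht]
      refine inv_eq_of_mul_eq_one_right ?_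
      rw [← pow_succ', Nat.sub_add_cancel h1, ht]
    rw [toZModPow_det_galoisRepTate_eq W ℓ hℓ n (exists_weilPairing_holds W _) c _ hct, map_neg,
      map_one, Nat.cast_sub h1, ZMod.natCast_self, Nat.cast_one, zero_sub]

/-! ## Silverman, *Advanced Topics*, Thm. II.2.2: `End_ℚ(E) = ℤ` -/

/-- **Discharge of the named fact `WeierstrassCurve.not_hasRationalCM`: no elliptic curve over `ℚ`
has `ℚ`-rational complex multiplication, `End_ℚ(E) = ℤ`.** Silverman, *Advanced Topics*,
Thm. II.2.2(a) (`[α]_E^σ = [α^σ]_{E^σ}`) with Remark II.2.2.2 (`σ` = complex conjugation): an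
endomorphism defined over `ℚ` commutes with complex conjugation, which forces it to be "real",
hence in `ℤ`. The proof given here is the `ℓ`-adic transcription described in the module
docstring: for `φ ∈ End_ℚ(E) ∖ ℤ` the discriminant `D = t² - 4 deg φ`,
`t = 1 + deg φ - deg(1 - φ)`, is negative (`deg(2φ - t) = -D > 0`), hence a non-residue at some odd
prime `ℓ`; but `φ_ℓ` commutes with the reflection `ρ_ℓ(c)` (`det ρ_ℓ(c) = -1` by the Weil pairing),
so `D = tr(φ_ℓ)² - 4 det(φ_ℓ)` is a square modulo `ℓ`.
[cite: SilvermanAdvancedTopics1994, Thm. II.2.2(a) and Remark II.2.2.2] -/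
theorem not_hasRationalCM_holds : not_hasRationalCM := by
  intro W _ hCM
  obtain ⟨φ, hφ, hφn⟩ := hCM
  haveI : CharZero (AlgebraicClosure ℚ) :=
    charZero_of_injective_algebraMap (algebraMap ℚ (AlgebraicClosure ℚ)).injective
  -- (0) `φ ≠ 0` and `1 - φ ≠ 0` are isogenies over `ℚ`
  have hφ0 : φ ≠ 0 := fun h ↦ hφn 0 (by rw [h, Int.cast_zero])
  have hφ1 : (1 - φ : AddMonoid.End W.geomPoints) ≠ 0 := fun h ↦
    hφn 1 (by rw [Int.cast_one]; exact (sub_eq_zero.mp h).symm)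
  obtain ⟨φI, hφI⟩ := W.exists_isogeny_of_mem_endRing hφ hφ0
  obtain ⟨φI₁, hφI₁⟩ := W.exists_isogeny_of_mem_endRing (sub_mem (one_mem _) hφ) hφ1
  -- the integers `d = deg φ`, `t = 1 + deg φ - deg(1 - φ)` and `D = t² - 4d`
  set d : ℤ := (φI.deg : ℤ) with hd
  set t : ℤ := 1 + d - (φI₁.deg : ℤ) with ht
  set D : ℤ := t ^ 2 - 4 * d with hD
  -- (1) for every prime `ℓ`: matrices, with `det R(φ) = d` and `tr R(φ) = t`
  have key : ∀ (ℓ : ℕ) [Fact ℓ.Prime],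
      ∃ (R : AddMonoid.End W.geomPoints →+* Matrix (Fin 2) (Fin 2) ℤ_[ℓ])
        (S : Field.absoluteGaloisGroup ℚ →* Matrix (Fin 2) (Fin 2) ℤ_[ℓ]),
        (∀ ψ : Isogeny W W, (R ψ.toAddMonoidHom).det = ψ.deg) ∧
        (∀ σ, (S σ).det =
          LinearMap.det (W.galoisRepTate ℓ σ : W.tateModule ℓ →ₗ[ℤ_[ℓ]] W.tateModule ℓ)) ∧
        (∀ f ∈ W.equivariantSubring, ∀ σ, R f * S σ = S σ * R f) ∧
        (R φ).det = d ∧ (R φ).trace = t := by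
    intro ℓ _
    have hℓ : (ℓ : ℚ) ≠ 0 := Nat.cast_ne_zero.mpr (Fact.out : ℓ.Prime).ne_zero
    obtain ⟨R, S, hR, hS, hRS⟩ := W.exists_tateMatrixRep ℓ hℓ
    have hdet : (R φ).det = d := by
      rw [hd, Int.cast_natCast, ← hφI, hR]
    have hdet₁ : (1 - R φ).det = ((φI₁.deg : ℤ) : ℤ_[ℓ]) := by
      rw [Int.cast_natCast, ← map_one R, ← map_sub, ← hφI₁, hR]
    refine ⟨R, S, hR, hS, hRS, hdet, ?_⟩
    rw [Matrix.trace_fin_two_eq_one_add_det_sub_det (R φ), hdet, hdet₁, ht]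
    push_cast
    ring
  -- (2) `D < 0`: `ψ = 2φ - t` is a non-zero endomorphism of degree `-D`
  have hDneg : D < 0 := by
    set ψ : AddMonoid.End W.geomPoints := φ + φ - (t : AddMonoid.End W.geomPoints) with hψ
    have hψmem : ψ ∈ W.endRing := sub_mem (add_mem hφ hφ) (intCast_mem _ t)
    have hψ0 : ψ ≠ 0 := by
      intro h0
      have hall : ∀ P : W.geomPoints, φ P + φ P = t • P := fun P ↦ by
        have h := congrArg (fun g : AddMonoid.End W.geomPoints ↦ g P) h0
        change φ P + φ P - (t : AddMonoid.End W.geomPoints) P = 0 at h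
        rwa [AddMonoid.End.intCast_apply, sub_eq_zero] at h
      obtain ⟨P, hP2, hP0⟩ := W.exists_two_torsion_ne_zero (Nat.cast_ne_zero.mpr two_ne_zero)
      rcases Int.even_or_odd t with ⟨s, hs⟩ | ⟨s, hs⟩
      · -- `t = 2s`: `2 (φ - s) = 0`, so `φ = [s]`
        refine hφn s (sub_eq_zero.mp (W.eq_zero_of_mem_endRing_of_zsmul_apply_eq_zero
          (sub_mem hφ (intCast_mem _ s)) (two_ne_zero (α := ℤ)) fun Q ↦ ?_))
        change (2 : ℤ) • (φ Q - (s : AddMonoid.End W.geomPoints) Q) = 0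
        rw [AddMonoid.End.intCast_apply, smul_sub, two_zsmul, hall Q, hs, add_zsmul, two_zsmul,
          sub_self]
      · -- `t = 2s + 1`: a point `P` of order `2` would satisfy `P = t • P = φ(2P) = O`
        apply hP0
        have h1 : t • P = 0 := by rw [← hall P, ← map_add, ← two_zsmul, hP2, map_zero]
        rwa [hs, add_zsmul, one_zsmul, mul_comm, mul_zsmul, hP2, zsmul_zero, zero_add] at h1
    obtain ⟨ψI, hψI⟩ := W.exists_isogeny_of_mem_endRing hψmem hψ0
    have hpos : 0 < ψI.deg := Isogeny.deg_pos_holds ψI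
    haveI : Fact (Nat.Prime 3) := ⟨Nat.prime_three⟩
    obtain ⟨R, S, hR, -, -, hdet, htr⟩ := key 3
    have h1 : (R ψ).det = ((ψI.deg : ℤ) : ℤ_[3]) := by rw [Int.cast_natCast, ← hψI, hR]
    have h2 : (R ψ).det = ((-D : ℤ) : ℤ_[3]) := by
      rw [hψ, map_sub, map_add, map_intCast, Matrix.det_add_self_sub_intCast_fin_two, hdet, htr, hD]
      push_cast
      ring
    have h3 : (ψI.deg : ℤ) = -D := Int.cast_injective (h1.symm.trans h2)
    omega
  -- (3) an odd prime `ℓ` at which `D` is a quadratic non-residue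
  obtain ⟨ℓ, hℓp, hℓ2, hJ⟩ := exists_prime_jacobiSym_eq_neg_one hDneg
  haveI : Fact ℓ.Prime := ⟨hℓp⟩
  have hns : ¬ IsSquare ((D : ℤ) : ZMod ℓ) := ZMod.nonsquare_iff_jacobiSym_eq_neg_one.mp hJ
  have h2 : (2 : ZMod ℓ) ≠ 0 := by
    intro h
    have h' : ((2 : ℕ) : ZMod ℓ) = 0 := by exact_mod_cast h
    rw [ZMod.natCast_eq_zero_iff] at h'
    exact hℓ2 ((Nat.prime_dvd_prime_iff_eq hℓp Nat.prime_two).mp h')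
  -- (4) complex conjugation: `det ρ_ℓ(c) = -1`, `ρ_ℓ(c)² = 1`, commuting with `φ_ℓ`
  obtain ⟨c, hcc, hc⟩ := exists_absoluteGaloisGroup_rat_smul_eq_inv
  have hℓQ : (ℓ : ℚ) ≠ 0 := Nat.cast_ne_zero.mpr hℓp.ne_zero
  have hdetc := W.det_galoisRepTate_eq_neg_one_of_smul_eq_inv ℓ hℓQ hc
  obtain ⟨R, S, -, hS, hRS, hdet, htr⟩ := key ℓ
  -- (5) reduce modulo `ℓ` and apply the reflection lemma
  set r : ℤ_[ℓ] →+* ZMod ℓ := PadicInt.toZMod with hr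
  have hsq := isSquare_trace_sq_sub_four_mul_det h2 (A := r.mapMatrix (R φ))
    (C := r.mapMatrix (S c))
    (by rw [← map_mul, ← map_mul, hcc, map_one, map_one])
    (by rw [← RingHom.map_det, hS, hdetc, map_neg, map_one])
    (by rw [← map_mul, ← map_mul, hRS φ hφ.2 c])
  have htr' : (r.mapMatrix (R φ)).trace = (t : ZMod ℓ) := by
    rw [RingHom.mapMatrix_apply, ← AddMonoidHom.map_trace, htr, map_intCast]
  have hdet' : (r.mapMatrix (R φ)).det = (d : ZMod ℓ) := by
    rw [← RingHom.map_det, hdet, map_intCast]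
  rw [htr', hdet'] at hsq
  apply hns
  rw [hD]
  push_cast
  exact hsq

end WeierstrassCurve
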